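import Summits.BirchSwinnertonDyer.BirchSwinnertonDyer.Theorems.SignedBaseChangeTwistPairGreenbergProductDivisibilityStubFrameData
import Summits.BirchSwinnertonDyer.BirchSwinnertonDyer.Theorems.TwoAdicConverseOrdLambdaHalfAtTwoWbarRealQuadratic
import Summits.BirchSwinnertonDyer.BirchSwinnertonDyer.Theorems.TwoAdicConverseOrdLambdaHalfAtTwoXiComplement
import Summits.BirchSwinnertonDyer.Rank1Residual.X11b.TransvectionAbsIrreducible
import Literature.NumberTheory.EllipticCurves.GoodReductionUnramifiedProofs
import Literature.NumberTheory.EllipticCurves.LFunctionPrimeCoeff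
import Literature.NumberTheory.EllipticCurves.HidaFamilyMembersProofs
import Literature.NumberTheory.EllipticCurves.ZpExtensionProofs
import Literature.NumberTheory.QuadraticFields.HeegnerCondition
import HarnessLib

/-!
# Route `TwoAdicConverse` (rung S3), crux `OrdLambdaHalfAtTwo` (item stmt-BirchSwinnertonDyer-19556), line
# `xi_dominant_klingen_two` (habitat S₃), stub `stub_supplyAtTwo`: the field (irr_K) of `XiDatum` AT `p = 2` —
# `ρ̄_{E,2}|_{Γ_K}` is absolutely irreducible when `ρ̄_{E,2}` is surjective and `K` is ramified at a good prime

Cell `bsd-2adic`, seat `bsd-2adic-conv-1` GEN 27 (`--supports` stmt-BirchSwinnertonDyer-19556, helper).  The tree's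
(sur) ⟹ (irr_K) transfer `SignedBaseChangeK1FrameData.irrK_framed_of_surj` needs `p ≠ 2`: a surjective `ρ̄` contains a
transvection, and «irreducible + transvection + char ≠ 2» survives restriction to any index-`2` subgroup.  At `p = 2` this is
false in general — `GL₂(𝔽₂) ≅ S₃` and `Γ_K` may land in `A₃`, which is irreducible but NOT absolutely irreducible over `𝔽₂`;
this happens exactly for `K = ℚ(√Δ_E)`.  This file proves the `p`-uniform replacement used by the `ξ`-datum:

* §1 `map_eq_top_of_index_two` — group lemma: `f : G ↠ G'`, `H ≤ G` of index `2`, and some `g ∉ H` with `f g = 1` ⟹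
  `f(H) = G'`.
* §2 `exists_apply_eq_of_hasSurjectiveModNGaloisRep` — under (sur) every matrix of `GL₂(𝔽_p)` is a value of every framing
  `ρ̄` of `E[p]` (the template's `exists_transvection_of_surj` for an arbitrary matrix).
* §3 `isIrreducible_comp_of_forall_exists` — irreducibility of a framed representation depends only on its IMAGE: if
  `ρ ∘ f` and `ρ` have the same values then `ρ` irreducible ⟹ `ρ ∘ f` irreducible (order isomorphism of subrepresentation
  lattices).
* §4 `smul_geomSqrt_eq_of_mem_range` — every element of `res Γ_K ≤ Γ_ℚ` fixes `√d ∈ ℚ̄` as soon as `d` is a square in `K`;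
  `exists_mem_inertia_not_mem_range` — if `d = d_K = -q` with `q` an odd prime then some element of the inertia group of a
  prime of `\bar ℤ` above `q` is NOT in `res Γ_K` (else `I_𝔓` fixes `√(-q)` and `2 ∣ ord_q(-q) = 1`, tree
  `TwoAdicWbarStep.two_dvd_padicValRat_of_forall_inertia_smul_eq`).
* §5 `galoisRep_eq_one_of_mem_inertia` — a framing of `E[p]` is trivial on the inertia at a prime `q ≠ p` of good reduction
  (Néron–Ogg–Shafarevich, easy half, tree `galoisRepTorsion_eq_one_of_mem_inertia`).
* §6 `irrK_framed_of_surj_of_discr` — **(sur) at `p` + `d_K = -q`, `q ∤ pN` an odd prime ⟹ every `𝔽_p`-framing of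
  `E_K[p]` is absolutely irreducible**, for EVERY prime `p` (at `p = 2`: `K ≠ ℚ(√Δ_E)` because `K` ramifies at the good
  prime `q`): `ρ̄(res Γ_K) = GL₂(𝔽_p)` by §1 with `g ∈ I_𝔓 ∖ res Γ_K`, so `ρ̄ ∘ res` is irreducible (§3) with a transvection
  in its image, hence absolutely irreducible (`X11b.Transvection.isAbsolutelyIrreducible_of_transvection`, no parity
  hypothesis), and any other framing of `E_K[p]` is conjugate.

HONEST FRAMING.  Closes nothing by itself (supply for the unregistered xi line); BSD is not proved by any of this.
PARTITION (D-0054): none — RANK axis S3 × X5@2 stratum S₃ (supply).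

References: J.-P. Serre, Invent. Math. 15 (1972) §5.3 (image `GL₂(𝔽₂) ≅ S₃`, the field `ℚ(√Δ)`) [Serre1972];
Silverman, *AEC* VII.4.1, VIII.1.6 [SilvermanAEC2009]; BSTW arXiv:2409.01350 §9.4 (irr_L) [BurungaleSkinnerTianWan2024].
-/

-- D-0017: single-problem summit, the namespace repeats the problem name by design.
set_option linter.dupNamespace false
set_option autoImplicit false

noncomputable section

open scoped Classical MatrixGroups Matrix

open NumberField IsDedekindDomain Field WeierstrassCurve Rat.HeightOneSpectrum
  Literature.NumberTheory.GaloisRepresentations Literature.NumberTheory.EllipticCurves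

namespace Summit.BirchSwinnertonDyer.BirchSwinnertonDyer.Theorems.TwoAdicXiSupply

/-! ## §1 A group lemma -/

/-- **`f(H) = G'` for an index-`2` subgroup missing an element of `ker f`.**  If `f : G → G'` is onto, `H ≤ G` has index `2`,
and some `g ∉ H` has `f g = 1`, then `f(H) = G'`: otherwise `f(H)` has index `2`, `f⁻¹(f(H)) ⊇ H` has index `2` too, so
`f⁻¹(f(H)) = H ∋ g`. [folklore] -/
theorem map_eq_top_of_index_two {G G' : Type*} [Group G] [Group G'] {f : G →* G'} (hf : Function.Surjective f)
    {H : Subgroup G} (hH : H.index = 2) {g : G} (hg : g ∉ H) (hfg : f g = 1) : H.map f = ⊤ := by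
  by_contra hne
  have hdvd : (H.map f).index ∣ 2 := hH ▸ Subgroup.index_map_dvd H hf
  have hM2 : (H.map f).index = 2 := by
    rcases (Nat.dvd_prime Nat.prime_two).mp hdvd with h1 | h2
    · exact absurd (Subgroup.index_eq_one.mp h1) hne
    · exact h2
  have hle : H ≤ (H.map f).comap f := fun x hx ↦ Subgroup.mem_comap.mpr (Subgroup.mem_map_of_mem f hx)
  have hidx : ((H.map f).comap f).index = 2 := by rw [Subgroup.index_comap_of_surjective _ hf]; exact hM2
  have hgmem : g ∈ (H.map f).comap f := by rw [Subgroup.mem_comap, hfg]; exact one_mem _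
  exact hg (le_of_le_of_index_eq_two hle hH hidx hgmem)

/-- Corollary in «values» form: under the hypotheses of `map_eq_top_of_index_two`, for a homomorphism `ι : H' → G` with
range `H`, every value of `f` is a value of `f ∘ ι`. [folklore] -/
theorem forall_exists_apply_comp_eq {G G' H' : Type*} [Group G] [Group G'] [Group H'] {f : G →* G'}
    (hf : Function.Surjective f) (ι : H' →* G) (hH : ι.range.index = 2) {g : G} (hg : g ∉ Set.range ι)
    (hfg : f g = 1) (y : G) : ∃ x : H', f (ι x) = f y := by
  have hg' : g ∉ ι.range := fun h ↦ hg (MonoidHom.mem_range.mp h)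
  have htop := map_eq_top_of_index_two hf hH hg' hfg
  have hy : f y ∈ ι.range.map f := htop ▸ Subgroup.mem_top _
  obtain ⟨z, ⟨x, rfl⟩, hz⟩ := Subgroup.mem_map.mp hy
  exact ⟨x, hz⟩

/-! ## §2 Under (sur) every matrix is a value of every framing -/

section Sur

variable (W : WeierstrassCurve ℚ) (p : ℕ) [Fact p.Prime]

/-- **(sur) ⟹ the framing `ρ̄ : Γ_ℚ → GL₂(𝔽_p)` is onto**: every `M ∈ GL₂(𝔽_p)` is `ρ̄(σ)` for some `σ ∈ Γ_ℚ` (transport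
`M` to an automorphism of `E[p]` along the frame, realise it by (sur)). [cite: Serre1972, §4] -/
theorem exists_apply_eq_of_hasSurjectiveModNGaloisRep (hsurj : W.HasSurjectiveModNGaloisRep (p : ℤ))
    {ρ : ModPGaloisRep ℚ (ZMod p) 2} (hρ : W.IsTorsionGaloisRep p ρ) (M : GL (Fin 2) (ZMod p)) :
    ∃ σ : absoluteGaloisGroup ℚ, ρ σ = M := by
  obtain ⟨e, he⟩ := hρ
  -- `v ↦ M v` as an additive automorphism of `𝔽_p²`
  let τ : (Fin 2 → ZMod p) ≃+ (Fin 2 → ZMod p) :=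
    { toFun := fun v ↦ (M : Matrix (Fin 2) (Fin 2) (ZMod p)) *ᵥ v
      invFun := fun v ↦ ((M⁻¹ : GL (Fin 2) (ZMod p)) : Matrix (Fin 2) (Fin 2) (ZMod p)) *ᵥ v
      left_inv := fun v ↦ by
        simp only [Matrix.mulVec_mulVec, ← Units.val_mul, inv_mul_cancel, Units.val_one, Matrix.one_mulVec]
      right_inv := fun v ↦ by
        simp only [Matrix.mulVec_mulVec, ← Units.val_mul, mul_inv_cancel, Units.val_one, Matrix.one_mulVec]
      map_add' := fun v w ↦ Matrix.mulVec_add _ v w }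
  have hτ : ∀ v, τ v = (M : Matrix (Fin 2) (Fin 2) (ZMod p)) *ᵥ v := fun _ ↦ rfl
  let φ : geomTorsion W (p : ℤ) ≃+ geomTorsion W (p : ℤ) := (e.trans τ).trans e.symm
  obtain ⟨σ, hσ⟩ := hsurj (Multiplicative.ofAdd φ)
  have hσ' : ∀ P : geomTorsion W (p : ℤ), σ • P = φ P := fun P ↦ by
    have h := congrArg (fun f ↦ (Multiplicative.toAdd f) P) hσ
    simpa only [galoisRepTorsion_apply, toAdd_ofAdd] using h
  refine ⟨σ, Units.ext ?_⟩
  refine Matrix.toLin'.injective (LinearMap.ext fun w ↦ ?_)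
  simp only [Matrix.toLin'_apply]
  obtain ⟨P, rfl⟩ := e.surjective w
  rw [← he σ P, hσ' P]
  change e ((e.trans τ |>.trans e.symm) P) = _
  rw [AddEquiv.trans_apply, AddEquiv.trans_apply, AddEquiv.apply_symm_apply, hτ]

end Sur

/-! ## §3 Irreducibility depends only on the image -/

section Image

variable {G H : Type*} [Group G] [TopologicalSpace G] [Group H] [TopologicalSpace H]
  {A : Type*} [Field A] [TopologicalSpace A] {n : ℕ}

/-- **Irreducibility is a property of the image.**  If `f : H → G` and every value `ρ g` is some `ρ (f x)`, then the
subrepresentations of `ρ ∘ f` and of `ρ` are the same submodules of `Aⁿ`; in particular `ρ` irreducible ⟹ `ρ ∘ f`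
irreducible. [folklore] -/
theorem isIrreducible_comp_of_forall_exists (ρ : FramedRep G A n) (f : H →ₜ* G)
    (hf : ∀ g : G, ∃ x : H, ρ (f x) = ρ g) (hirr : ρ.IsIrreducible) :
    FramedRep.IsIrreducible (ρ.comp f) := by
  -- order isomorphism between the subrepresentation lattices
  let Φ : Subrepresentation (FramedRep.toRepresentation (ρ.comp f)) ≃o
      Subrepresentation (FramedRep.toRepresentation ρ) :=
    { toFun := fun S ↦ ⟨S.toSubmodule, fun g v hv ↦ by
        obtain ⟨x, hx⟩ := hf g
        have h := S.apply_mem_toSubmodule x hv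
        rw [FramedRep.toRepresentation_apply_apply] at h ⊢
        rw [← hx]
        exact h⟩
      invFun := fun S ↦ ⟨S.toSubmodule, fun x v hv ↦ by
        have h := S.apply_mem_toSubmodule (f x) hv
        rw [FramedRep.toRepresentation_apply_apply] at h ⊢
        exact h⟩
      left_inv := fun S ↦ Subrepresentation.toSubmodule_injective rfl
      right_inv := fun S ↦ Subrepresentation.toSubmodule_injective rfl
      map_rel_iff' := Iff.rfl }
  exact Φ.isSimpleOrder_iff.mpr hirr

end Image

/-! ## §4 `res Γ_K` fixes `√d` for `d` a square in `K`; inertia at a ramified prime does not -/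

section Sqrt

variable (K : Type) [Field K] [NumberField K]

/-- **`res Γ_K` fixes `√d`.**  If `θ ∈ K` has `θ² = d ∈ ℚ`, then every `g` in the image of `Γ_K → Γ_ℚ` fixes the chosen
square root `geomSqrt d ∈ ℚ̄`: `g` fixes the copy of `K` in `ℚ̄` pointwise (`mem_range_absGaloisRestrict_iff`), which
contains `±√d`. [folklore] -/
theorem smul_geomSqrt_eq_of_mem_range {d : ℚ} {θ : K} (hθ : θ ^ 2 = algebraMap ℚ K d)
    {g : absoluteGaloisGroup ℚ} (hg : g ∈ Set.range (absGaloisRestrict ℚ K)) :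
    g • WeierstrassCurve.geomSqrt d = WeierstrassCurve.geomSqrt d := by
  have hfix := (mem_range_absGaloisRestrict_iff (L := K) g).mp hg θ
  set y : AlgebraicClosure K := algebraMap K (AlgebraicClosure K) θ with hy
  set z : AlgebraicClosure K := absClosureEmbedding ℚ K (WeierstrassCurve.geomSqrt d) with hz
  have hy2 : y ^ 2 = ((d : ℚ) : AlgebraicClosure K) := by
    rw [hy, ← map_pow, hθ, eq_ratCast, map_ratCast]
  have hz2 : z ^ 2 = ((d : ℚ) : AlgebraicClosure K) := by
    rw [hz, ← map_pow, WeierstrassCurve.geomSqrt_sq, eq_ratCast, map_ratCast]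
  have hzy : z = y ∨ z = -y := by
    have h : z ^ 2 = y ^ 2 := by rw [hz2, hy2]
    exact sq_eq_sq_iff_eq_or_eq_neg.mp h
  have hfixz : absGaloisTransport (L := K) g z = z := by
    rcases hzy with h | h
    · rw [h]; exact hfix
    · rw [h, map_neg, hfix]
  apply (Literature.NumberTheory.EllipticCurves.absClosureEmbedding_bijective ℚ K).1
  rw [← absGaloisTransport_absClosureEmbedding, ← hz, hfixz]

/-- **Inertia at an odd prime dividing `d_K` exactly once is not inside `res Γ_K`.**  For `[K : ℚ] = 2` with
`d_K = -q`, `q` an odd prime, `v` the place of `ℚ` at `q` and `𝔓 ∣ v` a prime of `\bar ℤ`: some `τ ∈ I_𝔓 ≤ Γ_ℚ` is not a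
restriction from `Γ_K` (else `I_𝔓` fixes `√(-q)`, tree `two_dvd_padicValRat_of_forall_inertia_smul_eq`, but
`ord_q(-q) = 1`). [cite: SilvermanAEC2009, Prop. VIII.1.6 (proof)] -/
theorem exists_mem_inertia_not_mem_range (h2 : Module.finrank ℚ K = 2) {q : ℕ} (hq : q.Prime) (hq2 : q ≠ 2)
    (hdisc : NumberField.discr K = -(q : ℤ)) {v : HeightOneSpectrum (𝓞 ℚ)} (hv : natGenerator v = q)
    {𝔓 : Ideal (absIntegers (𝓞 ℚ) ℚ)} (h𝔓 : 𝔓 ∈ v.primesAbove) :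
    ∃ τ ∈ 𝔓.inertia (absoluteGaloisGroup ℚ), τ ∉ Set.range (absGaloisRestrict ℚ K) := by
  by_contra hall
  push Not at hall
  obtain ⟨-, -, δ, -, hδ⟩ := Literature.NumberTheory.QuadraticFields.Quadratic.exists_sq_eq_discr (K := K) h2
  have hθ : ((δ : K)) ^ 2 = algebraMap ℚ K (-(q : ℚ)) := by
    have h := congrArg (algebraMap (𝓞 K) K) hδ
    rw [map_pow, hdisc] at h
    rw [h]
    simp
  have hq0 : (-(q : ℚ)) ≠ 0 := neg_ne_zero.mpr (Nat.cast_ne_zero.mpr hq.ne_zero)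
  have hI : ∀ τ ∈ 𝔓.inertia (absoluteGaloisGroup ℚ),
      τ • WeierstrassCurve.geomSqrt (-(q : ℚ)) = WeierstrassCurve.geomSqrt (-(q : ℚ)) :=
    fun τ hτ ↦ smul_geomSqrt_eq_of_mem_range K hθ (hall τ hτ)
  have h := TwoAdicWbarStep.two_dvd_padicValRat_of_forall_inertia_smul_eq hq hq2 hv h𝔓 hq0 hI
  haveI : Fact q.Prime := ⟨hq⟩
  have hval : padicValRat q (-(q : ℚ)) = 1 := by
    rw [padicValRat.neg, show ((q : ℚ)) = ((q : ℕ) : ℚ) from rfl, padicValRat.self hq.one_lt]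
  rw [hval] at h
  omega

end Sqrt

/-! ## §5 Inertia at a good prime `q ≠ p` acts trivially through every framing of `E[p]` -/

section Unramified

variable (W : WeierstrassCurve ℚ) [W.IsElliptic] (p : ℕ) [Fact p.Prime]

/-- **Néron–Ogg–Shafarevich (easy half) for a framing.**  If `W` has good reduction at the place `v` of `ℚ`, `p ∉ v`, and
`ρ̄` is a framing of `E[p]`, then `ρ̄(τ) = 1` for every `τ` in the inertia group of a prime of `\bar ℤ` above `v` (tree
`galoisRepTorsion_eq_one_of_mem_inertia`, Silverman VII.4.1(a)). [cite: SilvermanAEC2009, Prop. VII.4.1(a)] -/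
theorem galoisRep_eq_one_of_mem_inertia {v : HeightOneSpectrum (𝓞 ℚ)} (hgood : W.HasGoodReductionAt v)
    (hpv : ((p : ℕ) : 𝓞 ℚ) ∉ v.asIdeal) {ρ : ModPGaloisRep ℚ (ZMod p) 2} (hρ : W.IsTorsionGaloisRep p ρ)
    {𝔓 : Ideal (absIntegers (𝓞 ℚ) ℚ)} (h𝔓 : 𝔓 ∈ v.primesAbove)
    {τ : absoluteGaloisGroup ℚ} (hτ : τ ∈ 𝔓.inertia (absoluteGaloisGroup ℚ)) : ρ τ = 1 := by
  obtain ⟨e, he⟩ := hρ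
  have hpv' : (((p : ℕ) : ℤ) : 𝓞 ℚ) ∉ v.asIdeal := by rwa [Int.cast_natCast]
  have htriv : ∀ P : geomTorsion W ((p : ℕ) : ℤ), τ • P = P := fun P ↦
    W.smul_geomTorsion_eq_of_mem_inertia hgood hpv' h𝔓 hτ P
  refine Units.ext ?_
  refine Matrix.toLin'.injective (LinearMap.ext fun w ↦ ?_)
  simp only [Matrix.toLin'_apply, Units.val_one, Matrix.one_mulVec]
  obtain ⟨P, rfl⟩ := e.surjective w
  rw [← he τ P, htriv P]

end Unramified

/-! ## §6 (sur) + a good prime ramified in `K` ⟹ (irr_K), at every `p` -/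

section IrrK

variable (W : WeierstrassCurve ℚ) [W.IsElliptic] (p : ℕ) [Fact p.Prime]

/-- **The image of `Γ_K` under a surjective `ρ̄_{E,p}` is still everything** when `K` (quadratic, `d_K = -q`) is ramified
at an odd prime `q ≠ p`, `q ∤ N_E` (good reduction): every value of `ρ̄` is a value of `ρ̄ ∘ res_K`. [cite: Serre1972, §5.3] -/
theorem forall_exists_apply_absGaloisRestrict_eq (hsurj : W.HasSurjectiveModNGaloisRep (p : ℤ))
    {ρ : ModPGaloisRep ℚ (ZMod p) 2} (hρ : W.IsTorsionGaloisRep p ρ)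
    (K : Type) [Field K] [NumberField K] (h2 : Module.finrank ℚ K = 2)
    {q : ℕ} (hq : q.Prime) (hq2 : q ≠ 2) (hqp : q ≠ p) (hdisc : NumberField.discr K = -(q : ℤ))
    (hqN : ¬ q ∣ W.conductorNorm ℤ) (g : absoluteGaloisGroup ℚ) :
    ∃ x : absoluteGaloisGroup K, ρ (absGaloisRestrict ℚ K x) = ρ g := by
  haveI : FiniteDimensional ℚ K := Module.finite_of_finrank_eq_succ h2
  haveI hqF : Fact q.Prime := ⟨hq⟩
  have hgood : W.HasGoodReductionAtPrime q := hasGoodReductionAtPrime_of_not_dvd_conductorNorm W hqN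
  -- the place of `ℚ` at `q` and a prime of `\bar ℤ` above it
  set v : HeightOneSpectrum (𝓞 ℚ) := (primesEquiv (R := 𝓞 ℚ)).symm ⟨q, hq⟩ with hvdef
  have hv : natGenerator v = q := TwoAdicWbarStep.natGenerator_primesEquiv_symm hq
  have hpe : primesEquiv v = ⟨q, hq⟩ := (primesEquiv (R := 𝓞 ℚ)).apply_symm_apply ⟨q, hq⟩
  obtain ⟨𝔓, h𝔓⟩ := v.primesAbove_nonempty
  obtain ⟨τ, hτI, hτ⟩ := exists_mem_inertia_not_mem_range K h2 hq hq2 hdisc hv h𝔓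
  -- good reduction at `v`, `p ∉ v`
  have hgood' : W.HasGoodReductionAt v := by
    haveI := Fact.mk (primesEquiv v).2
    refine (hasGoodReductionAtPrime_iff_hasGoodReductionAt_ringOfIntegers v W).mp ?_
    have : ((primesEquiv v : Nat.Primes) : ℕ) = q := by rw [hpe]
    convert hgood
  have hpv : ((p : ℕ) : 𝓞 ℚ) ∉ v.asIdeal := by
    rw [Rat.natCast_mem_asIdeal_iff, hv, Nat.prime_dvd_prime_iff_eq hq (Fact.out : p.Prime)]
    exact hqp
  have hρτ : ρ τ = 1 := galoisRep_eq_one_of_mem_inertia W p hgood' hpv hρ h𝔓 hτI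
  -- the group lemma
  have hidx : (absGaloisRestrict ℚ K).toMonoidHom.range.index = 2 := by
    have h := (Literature.NumberTheory.Automorphic.isOpen_range_absGaloisRestrict_and_index ℚ K).2
    rw [h2] at h
    exact h
  have hsurjρ : Function.Surjective ρ.toMonoidHom := fun M ↦
    exists_apply_eq_of_hasSurjectiveModNGaloisRep W p hsurj hρ M
  have hτ' : τ ∉ Set.range (absGaloisRestrict ℚ K).toMonoidHom := hτ
  exact forall_exists_apply_comp_eq hsurjρ (absGaloisRestrict ℚ K).toMonoidHom hidx hτ' hρτ g

/-- **(sur) ⟹ (irr_K), framed, at EVERY prime `p`, for `K` ramified at a good odd prime `q ≠ p`.**  For `E/ℚ`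
(globally minimal `W`) with `ρ̄_{E,p}` surjective and a quadratic `K` with `d_K = -q`, `q` an odd prime, `q ≠ p`,
`q ∤ N_E`: EVERY `𝔽_p`-framing of `E_K[p]` is absolutely irreducible.  At `p = 2` this is «`ρ̄_{E,2}(Γ_K) = S₃` because
`K ≠ ℚ(√Δ_E)`» (`K` ramifies at the good prime `q`, `ℚ(E[2])` does not), the (irr_K) field of the `ξ`-datum.
[cite: Serre1972, §5.3] [cite: BurungaleSkinnerTianWan2024, §9.4 (irr_L)] -/
theorem irrK_framed_of_surj_of_discr (hsurj : W.HasSurjectiveModNGaloisRep (p : ℤ))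
    (K : Type) [Field K] [NumberField K] (h2 : Module.finrank ℚ K = 2)
    {q : ℕ} (hq : q.Prime) (hq2 : q ≠ 2) (hqp : q ≠ p) (hdisc : NumberField.discr K = -(q : ℤ))
    (hqN : ¬ q ∣ W.conductorNorm ℤ)
    (ρ : ModPGaloisRep K (ZMod p) 2) (hρ : (W.baseChange K).IsTorsionGaloisRep p ρ) :
    FramedRep.IsAbsolutelyIrreducible ρ := by
  have hp : p.Prime := Fact.out
  haveI : NeZero ((p : ℕ) : ℚ) := ⟨by exact_mod_cast hp.ne_zero⟩
  obtain ⟨ρ₀, hρ₀⟩ := W.exists_isTorsionGaloisRep p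
  -- `ρ₀ ∘ res_K` has full image, hence is irreducible with a transvection in its image
  have himg := forall_exists_apply_absGaloisRestrict_eq W p hsurj hρ₀ K h2 hq hq2 hqp hdisc hqN
  have hirr₀ : FramedRep.IsIrreducible ρ₀ :=
    Literature.NumberTheory.Automorphic.BCDT.isIrreducible_of_hasIrreducibleModPGaloisRep
      (hasIrreducibleModPGaloisRep_of_hasSurjectiveModNGaloisRep W p hsurj) hρ₀
  have hirrK : FramedRep.IsIrreducible (ρ₀.comp (absGaloisRestrict ℚ K)) :=
    isIrreducible_comp_of_forall_exists ρ₀ (absGaloisRestrict ℚ K) himg hirr₀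
  obtain ⟨σ, hne, hsq⟩ := SignedBaseChangeK1FrameData.exists_transvection_of_surj W p hsurj hρ₀
  obtain ⟨x, hx⟩ := himg σ
  have habs : FramedRep.IsAbsolutelyIrreducible (ρ₀.comp (absGaloisRestrict ℚ K)) := by
    refine Summit.BirchSwinnertonDyer.Rank1Residual.X11b.Transvection.isAbsolutelyIrreducible_of_transvection
      (ρ₀.comp (absGaloisRestrict ℚ K)) hirrK x ?_ ?_
    · change (((ρ₀ (absGaloisRestrict ℚ K x)) : GL (Fin 2) (ZMod p)) : Matrix (Fin 2) (Fin 2) (ZMod p)) ≠ 1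
      rw [hx]; exact hne
    · change ((((ρ₀ (absGaloisRestrict ℚ K x)) : GL (Fin 2) (ZMod p)) : Matrix (Fin 2) (Fin 2) (ZMod p)) - 1) *
        ((((ρ₀ (absGaloisRestrict ℚ K x)) : GL (Fin 2) (ZMod p)) : Matrix (Fin 2) (Fin 2) (ZMod p)) - 1) = 0
      rw [hx]; exact hsq
  -- transport to the given framing of `E_K[p]`
  have hρ₁ := SignedBaseChangeK1FrameData.isTorsionGaloisRep_baseChange_comp W p hρ₀ K
  obtain ⟨P, hP⟩ := hρ₁.exists_conj hρ
  rw [FramedRep.isAbsolutelyIrreducible_iff_coe] at habs ⊢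
  exact IsAbsIrreducible.of_conj _ _ P (fun γ ↦ hP γ) habs

end IrrK

end Summit.BirchSwinnertonDyer.BirchSwinnertonDyer.Theorems.TwoAdicXiSupply

end
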